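import Literature.NumberTheory.EllipticCurves.OverconvergentModularSymbolsWeightTwo
import Literature.NumberTheory.EllipticCurves.PAdicLFunctionDistributionHoldsProofs
import Literature.NumberTheory.EllipticCurves.TateModule
import HarnessLib

/-!
# Overconvergent modular symbols of weight two, II: the critical-slope eigen-lift `Φ_β` under the
# GALOIS-SIDE hypothesis "`V_pE|_{G_{ℚ_p}}` is not the direct sum of two characters" (Pollack–Stevens
# 2013 Thm. 1.2 / 8.1 with Bellaïche 2012 Prop. 2.12), and proved Hecke properties of the classical
# refinement `φ_β` (`φ_β|U_p = β φ_β`, `φ_β|ι = φ_β`)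

Companion to `OverconvergentModularSymbolsWeightTwo.lean` (definition item
`defn-OverconvergentModularSymbolsWeightTwo`, D5′ of the BSD route `SlopeDichotomyA2`; cell
`bsd-schneider-ideate`, memo `ROUTE-P3-D5prime-wt2OMS-g17.md`).  That file vends the critical-slope
eigen-lift `Φ_β` (its F2₀(b), `pollackStevens_criticalSlope_eigenLift`) under two hypotheses: the
tree's abstract stand-in for non-`θ`-criticality (`SpecializeInjOnEigenspace`) AND a DECENCY clause
`Squarefree N ∨ W.HasCM` needed to invoke Bellaïche's Theorem 1.  Pollack–Stevens' own theorem
(JLMS 2013, Thm. 1.2 = Thm. 8.1, quoted as Thm. 5.14 of the ENS paper) needs NO decency hypothesis: it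
needs exactly «`f_β ∉ im(θ_{k+1})`», and for a CUSPIDAL newform this is equivalent (Bellaïche 2012,
Prop. 2.12 (iii)⇔(v), after Breuil–Emerton) to «NOT (`v_p(β) > 0` and `ρ_f|_{D_p}` is the direct sum of
two characters)».  The Galois condition IS expressible in the tree (the rational Tate module of the base
change `W_{/ℚ_p}` with its `Γ_{ℚ_p}`-action, `WeierstrassCurve.rationalGaloisRepTate`), so this file
vends the memo's OTHER sanctioned form of F2₀(b):

* `IsLocallySplitAt W p` — DEFINITION: `V_p(W_{/ℚ_p})` is the direct sum of two non-zero
  `Γ_{ℚ_p}`-stable `ℚ_p`-subspaces ("`ρ_f|_{D_p}` is the direct sum of two characters", Bellaïche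
  Prop. 2.12 (iii)).  TRUE for CM curves at ordinary `p` (Prop. 2.14 (b)); for non-CM ordinary `W` its
  failure is EXPECTED but NOT KNOWN (Prop. 2.14 (a) — Greenberg's question); nothing of the kind is
  asserted here.
* `Uq`, `Uq₀` — the operators `U_q = ∑_{a mod q} ·|(1 a; 0 q)` for ANY `q` (the parent file hard-wires
  `q = p` in `Up`; Pollack–Stevens' Hecke algebra `ℋ = ℤ[T_ℓ (ℓ ∤ Np), U_q (q ∣ Np)]`, JLMS §6.2, also
  contains `U_q` for `q ∣ N`), and `IsEigenLiftFull W f β Φ` = the parent's `IsEigenLift` `∧`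
  `Φ|U_q = a_q(W) Φ` for the primes `q ∣ N`: an eigensymbol for the FULL algebra `ℋ` lifting `φ_β`.
* `pollackStevens2013_eigenLiftFull_of_not_isLocallySplitAt` — NAMED FACT (cite-only, `def … : Prop`):
  for `p` odd (Bellaïche's standing hypothesis), `p ∤ N`, `p` ordinary for `W`, `β` the root of
  `X² − a_pX + p` of critical slope `v_p(β) = 1`, and `¬ IsLocallySplitAt W p`, there is an
  `ℋ`-eigensymbol `Φ_β ∈ Symb_{Γ₀(Np)}(𝐃)^+` specialising to `φ_β`, UNIQUE among such (PS2013 p. 2: «if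
  `f` is not in the image of `θ_{k+1}` … we can associate a unique Hecke-eigensymbol `Φ_f ∈ H¹_c(Γ₀, 𝒟_k)`
  which specializes to `φ_f`», Def. 9.2).  No decency, no `SpecializeInjOnEigenspace`.  Net debt `+1`.
* PROVED classical API (zero debt), making the classical input of both doors non-vacuous:
  `Up₀_phiBeta` — `φ_β|U_p = β φ_β` from the tree's PROVED Hecke relation `a_p [r]⁺ = ∑_u [(r+u)/p]⁺ +
  [p r]⁺` (`intCast_mul_ratPlusSymbol`, Mazur–Tate–Teitelbaum (4.2)) and `[r + 1]⁺ = [r]⁺`; the curve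
  form `Up₀_phiBeta_of_isNewformOf`; `invol₀_phiClassical`, `invol₀_phiBeta` (`[−r]⁺ = [r]⁺`, cf. the
  tree's `ModularForms.ratPlusSymbol_neg`).

## Sources (held; pages read)

* [PollackStevens2013] R. Pollack, G. Stevens, *Critical slope `p`-adic `L`-functions*, J. Lond. Math.
  Soc. 87 (2013), doi:10.1112/jlms/jds057 (store `paper:doi-10-1112-jlms-jds057`): p. 1 setting («`f`
  … normalized cuspidal eigenform of weight `k+2` on `Γ₁(N)` … `p ∤ N` … `Γ₀ := Γ₁(N) ∩ Γ₀(p)`»);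
  **Thm. 1.2** p. 2 («Let `f` be an eigenform in `S_{k+2}(Γ₀, ℚ_p)` with slope `k+1`. Then
  `H¹_c(Γ₀, 𝒟_k)_{(f)} → H¹_c(Γ₀, Sym^k(ℚ_p²))_{(f)}` is an isomorphism if and only if `f ∉ im(θ_{k+1})`.
  … In particular, if `f` is not in the image of `θ_{k+1}` … we can associate a unique Hecke-eigensymbol
  `Φ_f ∈ H¹_c(Γ₀, 𝒟_k)` which specializes to `φ_f`»); §6.2 p. 14 («`ℋ` denotes the free polynomial
  algebra over `ℤ` generated by the Hecke operators `T_ℓ` for `ℓ ∤ Np` and `U_q` for `q ∣ Np`»; `V_(η)`);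
  **Thm. 8.1** p. 21; **Def. 9.2**, **Prop. 9.3** p. 22; Rem. 9.5 p. 23 («if `f` is in the image of
  `θ_{k+1}`, then `V_f` is locally split at `p`»).
* [PollackStevens2011] ENS 44 (store `paper:galaxy-pdf-7972659087883370800`): §2.1 p. 8 («If `q ∣ N`, we
  write `U_q` for `T_q`, and we have `φ|U_q = ∑_{a=0}^{q−1} φ|(1 a; 0 q)`»); **Thm. 5.14** p. 28 (the
  `𝐃_k`-valued form of PS2013 Thm. 1.2); §6.3 p. 30 (`φ_f^±`); §8 (`φ_β`).
* [Bellaiche2012] Invent. Math. 189 (store `paper:arxiv-0912.2925`): §1.2 p. 3 («a prime number `p` that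
  we shall assume odd and prime to `N`»); **Prop. 2.12** pp. 12–13 («(iii) We have `v_p(β) > 0` and the
  representation `(ρ_f)|_{D_p}` is the direct sum of two characters … In the case `f` is cuspidal, those
  properties are also equivalent to (v) The modular form `f_β` is in the image by the operator `θ_k`»,
  proof: «the equivalence between (v) and (iii) is a result of Breuil and Emerton»); **Def. 2.13**;
  **Prop. 2.14** p. 13 («(a) … it is expected, but not known in general, that `f_β` is non-critical …
  (b) [CM, `p` split] `f_β` is always critical»).
* [MazurTateTeitelbaum1986Invent] §I.4 (4.2), §I.10: the tree's `ratPlusSymbol`, `intCast_mul_ratPlusSymbol`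
  (PROVED in `PAdicLFunctionDistributionProofs`), `ratPlusSymbol_add_intCast_eq`.
* [Serre1968] / Silverman AEC III.§7: the tree's `WeierstrassCurve.rationalGaloisRepTate` (`TateModule.lean`).

## Design / scope

* `IsLocallySplitAt` reads `ρ|_{G_{ℚ_p}}` on the base change `W.baseChange ℚ_[p]` (geometric points over
  `ℚ̄_p`), which is the restriction of the global representation along a decomposition group at `p` up to
  the comparison isomorphism `tateModuleEquivOfEmb` (`TateModuleBaseChange.lean`); splitting is
  insensitive to that choice and to passing between `V_pE`, its dual and Tate twists.  Over `ℚ̄_p` versus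
  `ℚ_p`: at an ORDINARY prime the two characters of the ordinary filtration are distinct and
  `ℚ_p`-valued, so a splitting over `ℚ̄_p` descends; the definition asks for `ℚ_p`-subspaces.
* Level: PS2013 work at `Γ₀ = Γ₁(N) ∩ Γ₀(p)` with `ℋ` (no diamond operators); for `f` of trivial
  nebentypus the unique `ℋ`-eigen-lift `Φ_f` is fixed by the diamond operators (they commute with `ℋ` and
  with `ρ₀^*` and fix `φ_f`, so `⟨d⟩Φ_f` is another eigen-lift), i.e. lies in `Symb_{Γ₀(Np)}`; likewise
  `Φ_f|ι = Φ_f` for the `ι`-invariant `φ_f = φ_β^+`.  PS2011 Thm. 5.14 states the same isomorphism for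
  `𝐃_k`-valued symbols (`Γ₀ = Γ ∩ Γ₀(p)`, `Γ` of level `N`), which is the parent file's `OMSymb`.
* `p ≠ 2` is carried because the translation «not locally split ⇒ not `θ`-critical» is quoted from
  Bellaïche, whose paper assumes `p` odd throughout; Pollack–Stevens state no parity restriction.
* NOT here: the decency-free statement with the abstract hypothesis `SpecializeInjOnEigenspace` (it would
  need the `θ`-critical case of Thm. 8.1 read at level `Γ₀(Np)`); any claim that non-CM curves are not
  locally split (open); the power series `L_p(f_β, T)` (definition item `defn-CriticalSlopePAdicLFunction`).
-/

noncomputable section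

open scoped MatrixGroups ModularForm
open CongruenceSubgroup Literature.NumberTheory.EllipticCurves.ModularForms

namespace Literature.NumberTheory.EllipticCurves.OMSWeightTwo

variable {p : ℕ} [Fact p.Prime]

/-! ## §1 The Galois-side hypothesis: `V_pE` locally split at `p` -/

/-- **`V_p(W)` is LOCALLY SPLIT at `p`**: the rational `p`-adic Tate module of the base change
`W_{/ℚ_p}` (geometric points over `ℚ̄_p`), with its action of `Γ_{ℚ_p} = Gal(ℚ̄_p/ℚ_p)`
(`WeierstrassCurve.rationalGaloisRepTate`), is the direct sum of two non-zero `Γ_{ℚ_p}`-stable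
`ℚ_p`-subspaces — «the representation `(ρ_f)|_{D_p}` is the direct sum of two characters» (Bellaïche
2012, Prop. 2.12 (iii); for the newform `f` of `W`, `ρ_f ≅ V_p(W)` up to duality/twist, which does
not affect splitting).  For a CUSPIDAL newform and `v_p(β) > 0` this is equivalent to `f_β` being
`θ`-critical (Prop. 2.12 (iii)⇔(v), Breuil–Emerton), the obstruction in Pollack–Stevens' Thm. 1.2.
It HOLDS for CM curves at an ordinary (= split in the CM field) prime (Prop. 2.14 (b)); for non-CM
ordinary `W` its failure is «expected, but not known in general» (Prop. 2.14 (a)) — never assert it.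
A named HYPOTHESIS (a definition), not a fact. [cite: Bellaiche2012, Prop. 2.12 (iii) and Prop. 2.14 (arXiv:0912.2925 pp. 12–13)] -/
def IsLocallySplitAt (W : WeierstrassCurve ℚ) (p : ℕ) [Fact p.Prime] : Prop :=
  ∃ V₁ V₂ : Submodule ℚ_[p] ((W.baseChange ℚ_[p]).rationalTateModule p),
    V₁ ≠ ⊥ ∧ V₂ ≠ ⊥ ∧ V₁ ⊓ V₂ = ⊥ ∧ V₁ ⊔ V₂ = ⊤ ∧
    (∀ σ : Field.absoluteGaloisGroup ℚ_[p], ∀ v ∈ V₁,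
      (W.baseChange ℚ_[p]).rationalGaloisRepTate p σ v ∈ V₁) ∧
    (∀ σ : Field.absoluteGaloisGroup ℚ_[p], ∀ v ∈ V₂,
      (W.baseChange ℚ_[p]).rationalGaloisRepTate p σ v ∈ V₂)

/-- Unfolding lemma for `IsLocallySplitAt`. [cite: Bellaiche2012, Prop. 2.12 (iii) (arXiv:0912.2925 p. 12)] -/
theorem isLocallySplitAt_iff (W : WeierstrassCurve ℚ) (p : ℕ) [Fact p.Prime] :
    IsLocallySplitAt W p ↔
      ∃ V₁ V₂ : Submodule ℚ_[p] ((W.baseChange ℚ_[p]).rationalTateModule p),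
        V₁ ≠ ⊥ ∧ V₂ ≠ ⊥ ∧ V₁ ⊓ V₂ = ⊥ ∧ V₁ ⊔ V₂ = ⊤ ∧
        (∀ σ : Field.absoluteGaloisGroup ℚ_[p], ∀ v ∈ V₁,
          (W.baseChange ℚ_[p]).rationalGaloisRepTate p σ v ∈ V₁) ∧
        (∀ σ : Field.absoluteGaloisGroup ℚ_[p], ∀ v ∈ V₂,
          (W.baseChange ℚ_[p]).rationalGaloisRepTate p σ v ∈ V₂) :=
  Iff.rfl

/-! ## §2 `U_q` for every `q` and eigensymbols for the full Hecke algebra `ℋ` -/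

/-- **`U_q`** on `𝐃`-valued value functions for ANY `q`: `Φ|U_q = ∑_{a=0}^{q−1} Φ|(1 a; 0 q)`
(Pollack–Stevens: «If `q ∣ N`, we write `U_q` for `T_q`, and we have `φ|U_q = ∑ φ|(1 a; 0 q)`»);
`Uq p = Up` (`Uq_eq_Up`). [cite: PollackStevens2011, §2.1 (p. 8)] -/
def Uq (q : ℕ) (Φ : ℚ → Dist p) : ℚ → Dist p :=
  fun r => ∑ u ∈ Finset.range q, slash Φ (heckeMat u q) r

/-- `U_q` on classical (scalar) value functions: `(φ|U_q)(r) = ∑_{a=0}^{q−1} φ((r + a)/q)`.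
[cite: PollackStevens2011, §2.1 (p. 8)] -/
def Uq₀ (q : ℕ) (φ : ℚ → ℚ_[p]) : ℚ → ℚ_[p] :=
  fun r => ∑ u ∈ Finset.range q, slash₀ φ (heckeMat u q) r

/-- `U_p` of the parent file is `U_q` at `q = p`. [cite: PollackStevens2011, §2.1 (p. 8)] -/
theorem Uq_eq_Up (Φ : ℚ → Dist p) : Uq p Φ = Up Φ := rfl

/-- Classical version of `Uq_eq_Up`. [cite: PollackStevens2011, §2.1 (p. 8)] -/
theorem Uq₀_eq_Up₀ (φ : ℚ → ℚ_[p]) : Uq₀ p φ = Up₀ φ := rfl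

/-- `ρ₀^*` commutes with `U_q`. [cite: PollackStevens2011, §5 (p. 22): "ρ_k^* is Hecke-equivariant"] -/
theorem specializeFun_Uq (q : ℕ) (Φ : ℚ → Dist p) :
    specializeFun (Uq q Φ) = Uq₀ q (specializeFun Φ) := by
  funext r
  change (∑ u ∈ Finset.range q, slash Φ (heckeMat u q) r) 0 = ∑ u ∈ Finset.range q, _
  rw [Finset.sum_apply]
  exact Finset.sum_congr rfl fun u _ => congrFun (specializeFun_slash Φ (heckeMat u q)) r

/-- `U_q` is homogeneous. [cite: PollackStevens2011, §2.1 (p. 8)] -/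
theorem Uq_smul (q : ℕ) (c : ℚ_[p]) (Φ : ℚ → Dist p) : Uq q (c • Φ) = c • Uq q Φ := by
  funext r
  simp only [Uq, slash_smul, Pi.smul_apply, Finset.smul_sum]

/-- **`Φ` is an eigen-lift of `φ_β` for the FULL Hecke algebra `ℋ = ℤ[T_ℓ (ℓ ∤ Np), U_q (q ∣ Np)]`
of Pollack–Stevens** (JLMS §6.2): the parent file's `IsEigenLift W f β Φ` (`Φ|ι = Φ`,
`Φ|U_p = β Φ`, `Φ|T_ℓ = a_ℓ(W) Φ` for primes `ℓ ∤ Np`, `ρ₀^*(Φ) = φ_β`) together with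
`Φ|U_q = a_q(W) Φ` for the primes `q ∣ N` (the eigenvalues of the refinement `f_β` on `ℋ`:
`η_f(T_ℓ) = a_ℓ`, `η_f(U_q) = a_q`). [cite: PollackStevens2013, §6.2 (p. 14) and Thm. 1.2 (p. 2)] -/
def IsEigenLiftFull (W : WeierstrassCurve ℚ) {N : ℕ} (f : CuspForm (Gamma0 N) 2) (β : ℚ_[p])
    (Φ : OMSymb p (N * p)) : Prop :=
  IsEigenLift W f β Φ ∧
    ∀ q : ℕ, q.Prime → q ∣ N → Uq q Φ.toFun = (W.LFunction q : ℚ_[p]) • Φ.toFun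

/-- A full eigen-lift is an eigen-lift in the parent file's sense. [cite: PollackStevens2013, §6.2 (p. 14)] -/
theorem IsEigenLiftFull.isEigenLift {W : WeierstrassCurve ℚ} {N : ℕ} {f : CuspForm (Gamma0 N) 2}
    {β : ℚ_[p]} {Φ : OMSymb p (N * p)} (h : IsEigenLiftFull W f β Φ) : IsEigenLift W f β Φ :=
  h.1

/-! ## §3 The named fact: Pollack–Stevens' critical-slope eigen-lift under the Galois hypothesis -/

/-- **F2₀(b), Galois door — Pollack–Stevens 2013 Thm. 1.2 / 8.1 with Def. 9.2, via Bellaïche 2012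
Prop. 2.12 (cite-only named fact; nothing asserted).**  Let `W/ℚ` be an elliptic curve with newform
`f ∈ S₂(Γ₀(N))`, `p` an ODD prime with `p ∤ N` at which `W` is ordinary (`p ∤ a_p`), and `β ∈ ℚ_p`
the root of `X² − a_p X + p` of CRITICAL slope `v_p(β) = 1` (the refinement `f_β` of level `Γ₀(Np)`).
Assume `V_p(W)` is NOT locally split at `p` (`¬ IsLocallySplitAt W p`).  Then there is an
eigensymbol `Φ_β ∈ Symb_{Γ₀(Np)}(𝐃)^+` for the full Hecke algebra `ℋ` with the eigenvalues of `f_β`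
which specialises to `φ_β` (`IsEigenLiftFull`), and it is UNIQUE.  Chain of printed results: `f`
cuspidal, `p` odd, `v_p(β) = 1 > 0` and `ρ_f|_{D_p}` not a direct sum of two characters ⟹ `f_β ∉
im(θ₁)` (Bellaïche Prop. 2.12 (iii)⇔(v)); ⟹ «`H¹_c(Γ₀, 𝒟_k)_{(f)} → H¹_c(Γ₀, Sym^k)_{(f)}` is an
isomorphism … we can associate a unique Hecke-eigensymbol `Φ_f ∈ H¹_c(Γ₀, 𝒟_k)` which specializes to
`φ_f`» (PS2013 Thm. 1.2 / 8.1, Def. 9.2, `Γ₀ = Γ₁(N) ∩ Γ₀(p)`, `ℋ = ℤ[T_ℓ, U_q]`; PS2011 Thm. 5.14 for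
`𝐃`-valued symbols): applied to `φ_f := φ_β^+` (the tree's period normalisation differs from PS's
«size 1» by a scalar), the unique lift is fixed by the diamond operators and by `ι` (both commute with
`ℋ` and `ρ₀^*` and fix `φ_β^+`), so lies in `Symb_{Γ₀(Np)}(𝐃)^+ = OMSymb p (N * p)` with `invol = id`.
No decency hypothesis (contrast `pollackStevens_criticalSlope_eigenLift`).  Scope: `p ≠ 2` because the
Galois translation is quoted from Bellaïche (standing hypothesis `p` odd).
[cite: PollackStevens2013, Thm. 1.2 (p. 2), Thm. 8.1 (p. 21), Def. 9.2 (p. 22)]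
[cite: Bellaiche2012, Prop. 2.12 (iii)⇔(v) (arXiv:0912.2925 pp. 12–13)]
[cite: PollackStevens2011, Thm. 5.14 (p. 28)] -/
def pollackStevens2013_eigenLiftFull_of_not_isLocallySplitAt : Prop :=
  ∀ (p : ℕ) [Fact p.Prime] (W : WeierstrassCurve ℚ) [W.IsElliptic] {N : ℕ} [NeZero N]
    (f : CuspForm (Gamma0 N) 2), IsNewformOf W f → p ≠ 2 → ¬ p ∣ N → ¬ (p : ℤ) ∣ W.LFunction p →
    ∀ β : ℚ_[p], β ^ 2 - (W.LFunction p : ℚ_[p]) * β + p = 0 → Padic.valuation β = 1 →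
      ¬ IsLocallySplitAt W p →
      ∃ Φ : OMSymb p (N * p), IsEigenLiftFull W f β Φ ∧
        ∀ Φ' : OMSymb p (N * p), IsEigenLiftFull W f β Φ' → Φ'.toFun = Φ.toFun

/-! ## §4 Proved: Hecke properties of the classical refinement `φ_β` -/

section Classical

variable {N : ℕ} (f : CuspForm (Gamma0 N) 2)

/-- The classical `U_q` unfolded: `(φ|U_q)(r) = ∑_{u<q} φ((r + u)/q)`. [cite: PollackStevens2011, §2.1 (p. 8)] -/
theorem Uq₀_apply (q : ℕ) (hq : q ≠ 0) (φ : ℚ → ℚ_[p]) (r : ℚ) :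
    Uq₀ q φ r = ∑ u ∈ Finset.range q, φ ((r + u) / q) := by
  unfold Uq₀
  refine Finset.sum_congr rfl fun u _ => ?_
  have hq' : (q : ℚ) ≠ 0 := Nat.cast_ne_zero.2 hq
  simp [slash₀, moebius, heckeMat, extInfty, hq']

/-- The classical involution unfolded: `(φ|ι)(r) = φ(−r)`. [cite: PollackStevens2011, §2.1 (p. 8)] -/
theorem invol₀_apply (φ : ℚ → ℚ_[p]) (r : ℚ) : invol₀ φ r = φ (-r) := by
  simp [invol₀, slash₀, moebius, extInfty]

/-- **`φ_W` is a PLUS symbol**: `φ_W|ι = φ_W`, since `[−r]⁺ = [r]⁺` (`plusSymbol f (−r) = plusSymbol f r`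
by definition; also the tree's `ModularForms.ratPlusSymbol_neg` in `PAdicLFunctionIntegralityAtTwoProofs`,
not imported here to keep this file's imports light). [cite: PollackStevens2011, §2.1 (p. 8) and §6.3 (p. 30)] -/
theorem invol₀_phiClassical : invol₀ (phiClassical (p := p) f) = phiClassical f := by
  funext r
  have hneg : ratPlusSymbol f (-r) = ratPlusSymbol f r := by
    have h : normalizedPlusSymbol f (-r) = normalizedPlusSymbol f r := by
      simp only [normalizedPlusSymbol, plusSymbol, neg_neg, add_comm]
    unfold ratPlusSymbol
    rw [h]
  rw [invol₀_apply]
  simp [phiClassical, hneg]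

/-- **`φ_β` is a PLUS symbol**: `φ_β|ι = φ_β`. [cite: PollackStevens2011, §2.1 (p. 8) and §8 (p. 39)] -/
theorem invol₀_phiBeta (β : ℚ_[p]) : invol₀ (phiBeta (p := p) f β) = phiBeta f β := by
  funext r
  have hneg : ∀ x : ℚ, ratPlusSymbol f (-x) = ratPlusSymbol f x := fun x => by
    have h : normalizedPlusSymbol f (-x) = normalizedPlusSymbol f x := by
      simp only [normalizedPlusSymbol, plusSymbol, neg_neg, add_comm]
    unfold ratPlusSymbol
    rw [h]
  rw [invol₀_apply]
  simp [phiBeta, hneg, mul_neg]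

/-- **`φ_β|U_p = β φ_β`** for a normalised newform `f` with rational coefficients, `p ∤ N`,
`a_p(f) = a_p ∈ ℤ` and `β ≠ 0` a root of `X² − a_p X + p`: from the Hecke relation
`a_p [r]⁺ = ∑_{u mod p} [(r + u)/p]⁺ + [p r]⁺` (Mazur–Tate–Teitelbaum (4.2); PROVED in the tree as
`intCast_mul_ratPlusSymbol`) and `[r + u]⁺ = [r]⁺`: `(φ_β|U_p)(r) = (a_p [r]⁺ − [pr]⁺) − β⁻¹ p [r]⁺
= β [r]⁺ − [pr]⁺ = β φ_β(r)` since `a_p − p/β = β`.  (The same computation for `f_β = f − α f(pz)`: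
`U_p f_β = β f_β`.) [cite: MazurTateTeitelbaum1986Invent, §I.4 (4.2) and §I.10]
[cite: PollackStevens2011, §8 (p. 39), the critical slope symbol φ_β] -/
theorem Up₀_phiBeta [NeZero N] (hf : IsNewform0 f) (hQ : coeffField f = ⊥) (hpN : ¬ p ∣ N)
    {ap : ℤ} (hap : cuspCoeff f p = ap) {β : ℚ_[p]} (hβ0 : β ≠ 0)
    (hβ : β ^ 2 - (ap : ℚ_[p]) * β + p = 0) :
    Up₀ (phiBeta (p := p) f β) = β • phiBeta f β := by
  have hp : p.Prime := Fact.out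
  haveI : NeZero p := ⟨hp.ne_zero⟩
  have hrat : ∀ r : ℚ, (ratPlusSymbol f r : ℝ) = normalizedPlusSymbol f r :=
    fun r => ratCast_ratPlusSymbol_holds hf hQ r
  funext r
  rw [← Uq₀_eq_Up₀, Uq₀_apply p hp.ne_zero, Pi.smul_apply, smul_eq_mul]
  -- the Hecke relation (4.2), cast into `ℚ_p`
  have h42 : ((ap : ℚ_[p])) * (ratPlusSymbol f r : ℚ_[p]) =
      ∑ u ∈ Finset.range p, (ratPlusSymbol f ((r + u) / p) : ℚ_[p]) +
        (ratPlusSymbol f (p * r) : ℚ_[p]) := by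
    have h := intCast_mul_ratPlusSymbol p hf hp hpN hap hrat r
    rw [Fin.sum_univ_eq_sum_range (fun u : ℕ => ratPlusSymbol f ((r + u) / p))] at h
    have h' := congrArg (fun x : ℚ => (x : ℚ_[p])) h
    simpa [Rat.cast_sum] using h'
  -- periodicity: `[ (p (r+u))/p ]⁺ = [r + u]⁺ = [r]⁺`
  have hper : ∀ u ∈ Finset.range p,
      (ratPlusSymbol f (p * ((r + u) / p)) : ℚ_[p]) = (ratPlusSymbol f r : ℚ_[p]) := by
    intro u _
    have hp0 : (p : ℚ) ≠ 0 := Nat.cast_ne_zero.2 hp.ne_zero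
    have : (p : ℚ) * ((r + u) / p) = r + ((u : ℤ) : ℚ) := by field_simp; push_cast; ring
    rw [this, ratPlusSymbol_add_intCast_eq]
  simp only [phiBeta]
  rw [Finset.sum_sub_distrib, ← Finset.mul_sum, Finset.sum_congr rfl hper, Finset.sum_const,
    Finset.card_range, nsmul_eq_mul]
  -- algebra: `β² − a_p β + p = 0`
  have hsum : ∑ u ∈ Finset.range p, (ratPlusSymbol f ((r + u) / p) : ℚ_[p]) =
      (ap : ℚ_[p]) * (ratPlusSymbol f r : ℚ_[p]) - (ratPlusSymbol f (p * r) : ℚ_[p]) := by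
    rw [h42]; ring
  rw [hsum]
  have hβ' : (ap : ℚ_[p]) - β⁻¹ * p = β := by
    field_simp
    linear_combination -hβ
  have hββ : β * β⁻¹ = 1 := mul_inv_cancel₀ hβ0
  linear_combination ((ratPlusSymbol f r : ℚ_[p])) * hβ' +
    ((ratPlusSymbol f (p * r) : ℚ_[p])) * hββ

/-- **`φ_β|U_p = β φ_β` for the newform of an elliptic curve** (`IsNewformOf W f`: `f` is a normalised
newform with `a_n(f) = a_n(W) ∈ ℤ`, so `coeffField f = ℚ` and `a_p(f) = a_p(W)`), `p ∤ N`, `β ≠ 0` a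
root of `X² − a_p(W) X + p` — the `U_p`-clause of `IsEigenLift`/`IsEigenLiftFull` read classically.
[cite: MazurTateTeitelbaum1986Invent, §I.4 (4.2) and §I.10] -/
theorem Up₀_phiBeta_of_isNewformOf [NeZero N] {W : WeierstrassCurve ℚ} (hf : IsNewformOf W f)
    (hpN : ¬ p ∣ N) {β : ℚ_[p]} (hβ0 : β ≠ 0)
    (hβ : β ^ 2 - (W.LFunction p : ℚ_[p]) * β + p = 0) :
    Up₀ (phiBeta (p := p) f β) = β • phiBeta f β :=
  Up₀_phiBeta f hf.1 hf.coeffField_eq_bot hpN (ap := W.LFunction p) (hf.2 p) hβ0 hβ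

end Classical

end Literature.NumberTheory.EllipticCurves.OMSWeightTwo

end
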